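import Summits.BirchSwinnertonDyer.BirchSwinnertonDyer.Theses.UniversalToricDescent
import Summits.BirchSwinnertonDyer.BirchSwinnertonDyer.Theses.SemiOrdinaryEisensteinDescent
import Summits.BirchSwinnertonDyer.BirchSwinnertonDyer.Theorems.WildThreeRankOneBSDpOfExactIndexManin
import Summits.BirchSwinnertonDyer.BirchSwinnertonDyer.Theorems.WildThreeRankOneBSDpOfGlobalDivisibility
import Summits.BirchSwinnertonDyer.BirchSwinnertonDyer.Theorems.SchneiderFreeAdditiveX3UpperReceptacle
import Summits.BirchSwinnertonDyer.BirchSwinnertonDyer.Theorems.ClassRecordThreeStepLOfHalvesB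
import Literature.NumberTheory.EllipticCurves.BSDHeegnerPointsGrossZagierProofs
import Literature.NumberTheory.EllipticCurves.KrizLi2019.SexticTwistBSDThreeDescent
import Literature.NumberTheory.EllipticCurves.GlobalMinimalModelProofs
import Literature.NumberTheory.EllipticCurves.ModularCurveManinConstantProofs
import HarnessLib

/-!
# What UTD's wall crux `AdditiveSplitIMCInclusionAtThree` (stmt-BirchSwinnertonDyer-20395) buys BY ITSELF
# at the wild split prime `3`: (§1) the UPPER index socket at every Heegner datum — hence SOED's Kolyvagin
# crux `WildKolyvaginUpperAtThree` (20480) BY NAME, tower-free; (§2) with SOED's Eisenstein crux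
# `WildSplitEisensteinInclusionAtThree` (20479) the leaf `WAllExclAddWildRankOneSurj` — a CROSS-ROUTE
# kernel with NO twin, NO Kolyvagin system, NO `3`-adic tower; (§3) on a JET-exact datum `BSD₃(E)` from the
# inclusion alone (cell `bsd-wall`, D-0131 (3) M-UTD, seat `bsd-wall-utd-p3` gen 2, Manin-robust currency)

Routes `UniversalToricDescent` (UTD, rev 20) and `SemiOrdinaryEisensteinDescent` (SOED, rev 5) attack the
same leaf family (W-ALL/2@3.O6.r1: non-CM `E/ℚ` wild additive at `3`, `ρ̄_{E,3}` onto, `r_an = 1`) through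
the same Jetchev–Skinner–Wan §7.4 assembly (kernels `UniversalToricDescentToricKernelAtThree`, p533077, utd-p3
g0, item 20390; `SemiOrdinaryEisensteinDescentEisensteinKernelAtThree`, bed-p3 g1, item 20485): a Waldspurger/BDP frame
`L ∈ R₀⟦T⟧` of `f_E` with unit value at `(κ, γ, 𝔭)` (`WildSplitWaldspurgerAtThree`, 20385, shared), exact
anticyclotomic control at the other prime `𝔭′` (`WildSplitControlAtThree`, 20386, shared, closed modulo
published facts), the rank-zero wild leaf for the twist (`WildRankZeroTwistAtThree`, 20387, shared), and
kmc g17's exact-index descent p528981. They differ in HOW the two inclusions of the (∅,0) main conjecture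
for `f_E` at the additive point are obtained:
* UTD: the «⊇» inclusion `(L) ⊆ Ch_Λ(X_(∅,0))·R₀⟦T⟧` IS its child crux 20395 (the wall `S_div`); the «⊆»
  half comes from a semistable TWIN by Greenberg–Vatsal transport (20399 `InvariantsTransportModThree`,
  20400 `TwinMuZeroAtThree`, 20214 `TwinSplitIMCAtThree` in three buckets) — leaf `…SurjTwin`.
* SOED: the «⊆» inclusion IS its crux E 20479; the other half is Kolyvagin's upper bound Ko 20480 (split
  into J 20760 Σ-form global divisibility + published structure inputs), under the `3`-adic TOWER, with a
  residual corner 20484 for the non-tower rows — leaf `…Surj`.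

THIS FILE records, BY NAME over both route files, the three consequences of taking UTD's 20395 as the
«⊇» half:
* §1 `indexUpperBoundLeAt_of_additiveSplitIMCInclusionAtThree` — at ONE Heegner datum `(K, Dt, H, ι, P)`
  of a curve on the cell (`K` Heegner for `N(E)`, `L(E^{d_K},1) ≠ 0`, `P` the Heegner point, non-torsion):
  20395 + 20385 + 20386 + Kolyvagin's theorem (named) ⟹ `Upper.IndexUpperBoundLeAt W 3 K P (v₃ c)` (co-STEP
  L at Manin slack `v₃(c)`), via K1's receptacle `additiveIMCUpperBDPOnTreeLeAt_of_value_of_dvd'` and link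
  `indexUpperBoundLeAt_of_imcUpperLe_of_control`. COROLLARY
  **`wildKolyvaginUpperAtThree_of_additiveSplitIMCInclusionAtThree`: (∀ kolyvagin) → 20395 → 20385 → 20386
  → SOED's Ko 20480** — its binders `Odd d_K`, `d_K ≠ −3`, `TowerSurjThree W` are idle.
* §2 **`wAllExclAddWildRankOneSurj_of_inclusion_of_eisenstein`: `ToricPublishedInputs → 20395 → 20479 →
  20385 → 20386 → 20387 → WAllExclAddWildRankOneSurj`** — the CROSS-ROUTE KERNEL: UTD's «⊇» crux and
  SOED's «⊆» crux, both stated at `E` itself, close SOED's leaf with NO twin (20214/20399/20400 idle), NO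
  Kolyvagin input (20480/20760/20761 idle) and NO tower split (20484 idle). Proof = the SOED kernel with the
  upper socket supplied by §1 instead of Ko.
* §3 **`bsdp_three_of_indexLeTamagawaManin_of_additiveSplitIMCInclusionAtThree`** — the JET-PRODUCT
  sub-leaf in this currency: for `W` on the cell and ONE Heegner datum with odd `d_K`, `L(E^{d_K},1) ≠ 0` and
  `ord₃ [E(K):ℤP] ≤ ord₃ ∏_ℓ c_ℓ(E) + v₃(c)` (census shape `i3 = t3` at `c = 1`; `≤` suffices, equality
  follows): published inputs + 20395 + 20385 + 20386 + the rank-zero wild leaf `WAllExclAddWildRankZero` ⟹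
  `BSDp W 3`. The «⊆» half (SOED E / UTD twin transport) is IDLE there (gen 1's arithmetic
  `indexBounds_of_upper_of_index_le`). Compare gen 1's `bsdp_three_of_indexEqTamagawaManin_of_globalDivisibility…`
  (p540800 §3: same conclusion from J + McCallum + tower): here the research input is the Iwasawa-side
  inclusion 20395 instead of the Kolyvagin-side divisibility J, and no tower binder.

PARTITION currency (census `bsd-wall-census/blockA/BLOCK-A-index.md`, onto-W `r_an = 1` residue at `3`:
3 894 classes, R758 3 893; READ, not re-derived): §2 bears on ALL of them (leaf `…Surj`) from {20395,
20479} + ports; §3 on the JET-PRODUCT **3 413** (87.6 %) + the TAM3FREE-at-a-new-`D` 289 from {20395} +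
ports + leaf #6. Classes closed: 0. «beyond-print theorem»: NO — 20395 and 20479 are research-grade (every
printed inclusion at `E` needs a Λ-adic class from CM points, absent at `9 ∣ N` with `3` split, or
admissible primes, none at `3`; UTD/SOED why-might-fail texts), 20385's frame child 20928 is port-grade,
20386 is closed modulo seven cite-level facts, leaf #6 is the open rank-zero wild row.
HONEST FRAMING: every theorem is CONDITIONAL on the route items it names (antecedents) and on the named
published facts; nothing is booked; BSD is proved for no curve by this file. No definition, no named fact,
no `sorry`. References: [JetchevSkinnerWan2017] §7.4.1 (arXiv:1512.06894 p. 30); [Castella2018] Thm. 2.3,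
§5 (5.1)–(5.3); [GrossZagier1986] Thm. I.(6.3), V.§2; [FriedbergHoffstein1995] Thm. B; [GrossLMS1991]
(1.1), Thm. 1.3; [GreenbergVatsal2000] Thm. 1.4 (what §2 makes idle); [Jetchev2008] Conj. 1.3 (what §1
makes idle).
-/

noncomputable section

open scoped Classical

set_option linter.dupNamespace false
set_option autoImplicit false

namespace Summit.BirchSwinnertonDyer.BirchSwinnertonDyer.Theorems.WildThreeInclusionKernel

open WeierstrassCurve NumberField IsDedekindDomain Field
  Literature.NumberTheory.EllipticCurves
  Literature.NumberTheory.EllipticCurves.ModularForms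
  Literature.NumberTheory.EllipticCurves.Rank1Residual
  Literature.NumberTheory.EllipticCurves.KrizLi2019
  Summit.BirchSwinnertonDyer.Rank1Residual
  Summit.BirchSwinnertonDyer.Rank1Residual.Additive
  Summit.BirchSwinnertonDyer.Rank1Residual.X11b
  Summit.BirchSwinnertonDyer.Rank1Residual.X11b.AcSelmer
  Summit.BirchSwinnertonDyer.Rank1Residual.X11b.Halves
  Summit.BirchSwinnertonDyer.BirchSwinnertonDyer.Theses

/-! ### §1 The upper index socket at one Heegner datum from the inclusion `(L) ⊆ Ch_Λ(X_(∅,0))·R₀⟦T⟧` -/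

/-- **co-STEP L at Manin slack `v₃(c)` from UTD's inclusion crux, at ONE Heegner datum.** For `W/ℚ`
globally minimal on the wild cell (`ClassO6 W 3`, `ρ̄_{E,3}` onto, `r_an = 1`), `K` imaginary quadratic
Heegner for `N = N(E)` with `L(E^{d_K},1) ≠ 0`, `P` the Heegner point of the datum `(Dt, H, ι)` and `P` of
infinite order: Kolyvagin's theorem (named fact, hypothesis), `AdditiveSplitIMCInclusionAtThree` (UTD
20395), `WildSplitWaldspurgerAtThree` (20385) and `WildSplitControlAtThree` (20386) — all BY NAME, as
antecedents — give `Upper.IndexUpperBoundLeAt W 3 K P (v₃ c)`, i.e.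
`ord₃ #Ш(E/K) + 2·ord₃ ∏_ℓ c_ℓ(E) + 2·v₃(c) ≤ 2·ord₃ [E(K):ℤP]`. Assembly: frame `(κ, γ, 𝔭, 𝔭′ ≠ 𝔭)`,
Waldspurger frame `L` and unit value at `𝔭`, control count at `𝔭′`, the inclusion at the frame, the value
moved to `log_{𝔭′}` (rank one), K1's upper receptacle and link. CONDITIONAL; closes nothing.
[cite: JetchevSkinnerWan2017, §7.4.1 (arXiv:1512.06894 p. 30)] [cite: Castella2018, Thm. 2.3 and §5 (5.1)–(5.3)] -/
theorem indexUpperBoundLeAt_of_additiveSplitIMCInclusionAtThree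
    (hKo : ∀ (N : ℕ) [NeZero N] (W : WeierstrassCurve ℚ) (K : Type) [Field K] [NumberField K],
      kolyvagin N W K)
    (hI : UniversalToricDescent.AdditiveSplitIMCInclusionAtThree)
    (hV : UniversalToricDescent.WildSplitWaldspurgerAtThree)
    (hC : UniversalToricDescent.WildSplitControlAtThree)
    (W : WeierstrassCurve ℚ) [W.IsElliptic] [W.IsGloballyMinimal] (N : ℕ) [NeZero N]
    (K : Type) [Field K] [NumberField K] (Dt : ModularParametrizationData W N)
    (H : HeegnerDatum N (NumberField.discr K)) (ι : K →+* ℂ) (P : (W.baseChange K).toAffine.Point)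
    (hO6 : ClassO6 W 3) (hsurj : W.HasSurjectiveModNGaloisRep 3) (hr : W.analyticRank = 1)
    (hN : W.conductorNorm ℤ = N) (hK : IsImaginaryQuadratic K) (hHN : SatisfiesHeegnerHypothesis N K)
    (hLt : (W.quadraticTwist (NumberField.discr K : ℚ)).entireLFunction 1 ≠ 0)
    (hP : WeierstrassCurve.Affine.Point.map ι.toRatAlgHom P = heegnerPointComplex Dt H)
    (hnt : ¬ IsOfFinAddOrder P) :
    SchneiderFree.Upper.IndexUpperBoundLeAt W 3 K P (padicValNat 3 Dt.c.natAbs) := by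
  subst hN
  -- Kolyvagin: `rank E(K) = 1`, `Ш(E/K)` finite
  obtain ⟨hrk, hfin⟩ := hKo (W.conductorNorm ℤ) W K hK hHN ⟨Dt, H, ι, hP⟩ hnt
  -- `3 ∣ N(E)` (additive) splits in `K`
  have h3N : 3 ∣ W.conductorNorm ℤ :=
    (W.dvd_conductorNorm_iff_not_hasGoodReductionAtPrime 3).mpr (not_good_of_addv W 3 hO6.2.1)
  have hsplit : SplitsIn K 3 := hHN 3 Nat.prime_three h3N
  -- a frame `(κ, γ, 𝔭)` and the other prime `𝔭′ ≠ 𝔭` above `3`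
  obtain ⟨κ, γ, -, hκ, hγ, -⟩ := X11b.exists_anticyclotomic_generator_prime (p := 3) hK
  haveI : Fact (κ.IsTopGenerator γ) := ⟨hγ⟩
  obtain ⟨𝔭, h𝔭, he, hf⟩ := X11b.exists_degreeOnePrime_of_splitsIn K 3 hK.1 hsplit
  obtain ⟨𝔭', hne, h𝔭', he', hf'⟩ := X11b.Three.exists_ne_degreeOne_prime hK.1 h𝔭 he hf
  -- Waldspurger frame and unit value at `(κ, γ, 𝔭)`
  obtain ⟨ι', hind, ΩK, Ωp, L, hΩK, hΩp, hBDP, u, hval⟩ :=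
    hV W (W.conductorNorm ℤ) K Dt H ι P hO6 hsurj hr rfl hK hHN hLt hP hnt κ hκ γ 𝔭 h𝔭 he hf
  -- control count at `𝔭′` (CTL₀ included)
  have hctl : SchneiderFree.AdditiveControlOnTreeAt 3 κ 𝔭' γ (embAt K 3 𝔭' h𝔭' he' hf') P :=
    hC W (W.conductorNorm ℤ) K Dt H ι P hO6 hsurj hr rfl hK hHN hLt hP hnt (hKo _ W K) κ hκ γ 𝔭'
      h𝔭' he' hf'
  obtain ⟨n, hn, hneq⟩ := hctl
  -- THE INCLUSION `(L) ⊆ Ch_Λ(X_(∅,0) strict at 𝔭′)·R₀⟦T⟧` at the frame (UTD's crux, by name)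
  have hincl : Ideal.span {L} ≤
      (XAc.charIdeal (W.baseChange K) 3 κ 𝔭' ∅ γ).map (PowerSeries.map (toUnr 3)) :=
    hI W (W.conductorNorm ℤ) K Dt hO6 hsurj hr rfl hK hHN κ hκ γ 𝔭 h𝔭 he hf 𝔭' h𝔭' hne ι' hind
      ΩK Ωp L hΩK hΩp hBDP
  -- the value read through the logarithm at `𝔭′` (rank one: `(log_{𝔭′} P)² = (log_𝔭 P)²`)
  have hval' : L.HasValueAt 0 ((((u : unrIntegers 3) : unrIntegers 3) : ℂ_[3]) *
      (algebraMap ℚ_[3] ℂ_[3]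
        (logOmega W 3 (embAt K 3 𝔭' h𝔭' he' hf') P / (Dt.c : ℚ_[3]))) ^ 2) :=
    (SchneiderFreeAdditiveX3.hasValueAt_sq_logOmega_embAt_iff_of_rank_one W 3 hK.1 hrk h𝔭 he hf
      h𝔭' he' hf' P _ _ L).mpr hval
  -- the UPPER socket at slack `v₃(c)` at the frame `(κ, 𝔭′, γ, embAt 𝔭′)` (K1's receptacle), then the link
  have hc0 : Dt.c ≠ 0 := Dt.maninConstant_ne_zero_holds
  have hlog : logOmega W 3 (embAt K 3 𝔭' h𝔭' he' hf') P ≠ 0 := X11b.R1.logOmega_ne_zero W 3 _ hnt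
  have hup : SchneiderFree.Upper.AdditiveIMCUpperBDPOnTreeLeAt 3 κ 𝔭' γ (embAt K 3 𝔭' h𝔭' he' hf')
      (padicValNat 3 Dt.c.natAbs) P :=
    SchneiderFree.Upper.additiveIMCUpperBDPOnTreeLeAt_of_value_of_dvd' hn hincl u hc0 hlog hval'
  exact SchneiderFree.Upper.indexUpperBoundLeAt_of_imcUpperLe_of_control rfl hK hHN hfin hup ⟨n, hn, hneq⟩

/-- **SOED's Kolyvagin crux `WildKolyvaginUpperAtThree` (stmt-BirchSwinnertonDyer-20480) FOLLOWS from
UTD's inclusion crux `AdditiveSplitIMCInclusionAtThree` (20395) — BY NAME, given Kolyvagin's theorem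
(named), `WildSplitWaldspurgerAtThree` (20385) and `WildSplitControlAtThree` (20386).** Ko's extra binders
(`Odd d_K`, `d_K ≠ −3`, `TowerSurjThree W`) are idle. So on route SOED the pair {E 20479, Ko 20480} may be
replaced by {E 20479, UTD 20395} with no tower and no Kolyvagin-system input (cf. §2). CONDITIONAL.
[cite: JetchevSkinnerWan2017, §7.4.1 (arXiv:1512.06894 p. 30)] -/
theorem wildKolyvaginUpperAtThree_of_additiveSplitIMCInclusionAtThree
    (hKo : ∀ (N : ℕ) [NeZero N] (W : WeierstrassCurve ℚ) (K : Type) [Field K] [NumberField K],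
      kolyvagin N W K)
    (hI : UniversalToricDescent.AdditiveSplitIMCInclusionAtThree)
    (hV : UniversalToricDescent.WildSplitWaldspurgerAtThree)
    (hC : UniversalToricDescent.WildSplitControlAtThree) :
    SemiOrdinaryEisensteinDescent.WildKolyvaginUpperAtThree := by
  intro W _ _ N _ K _ _ Dt H ι P hO6 hsurj hr hN hK hHN hLt hP hnt _ _ _
  exact indexUpperBoundLeAt_of_additiveSplitIMCInclusionAtThree hKo hI hV hC W N K Dt H ι P hO6 hsurj hr
    hN hK hHN hLt hP hnt

/-! ### §2 The cross-route kernel: UTD's «⊇» crux + SOED's «⊆» crux ⟹ the leaf `WAllExclAddWildRankOneSurj` -/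

/-- **CROSS-ROUTE KERNEL at the wild split prime `3`: `ToricPublishedInputs → AdditiveSplitIMCInclusionAtThree
(UTD 20395) → WildSplitEisensteinInclusionAtThree (SOED 20479) → WildSplitWaldspurgerAtThree (20385) →
WildSplitControlAtThree (20386) → WildRankZeroTwistAtThree (20387) → WAllExclAddWildRankOneSurj`**
(`BSD₃(E)` for every globally minimal non-CM `E/ℚ` on `ClassO6 W 3` with `ρ̄_{E,3}` onto and `r_an = 1`).
Jetchev–Skinner–Wan's §7.4 assembly, Manin constant kept on both sides, BOTH inclusions stated at `E`
itself: parity and Friedberg–Hoffstein (`2` and all of `N(E)` split, so `d_K` odd), Heegner point,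
Gross–Zagier, Kolyvagin, frame `(κ, γ, 𝔭, 𝔭′)`, Waldspurger value at `𝔭`, control at `𝔭′` (torsion
guard of the Eisenstein crux), `⊆` ⟹ lower socket, `⊇` ⟹ upper socket (§1), both at slack `v₃(c)` ⟹
p528981. NO twin, NO Kolyvagin-system input, NO `3`-adic tower binder. CONDITIONAL on the five route items
named (antecedents); closes nothing. [cite: JetchevSkinnerWan2017, §7.4.1 (arXiv:1512.06894 p. 30)]
[cite: Castella2018, Thm. 2.3 and §5 (5.1)–(5.3)] [cite: GrossZagier1986, Thm. I.(6.3) and V.§2]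
[cite: FriedbergHoffstein1995, Thm. B] -/
theorem wAllExclAddWildRankOneSurj_of_inclusion_of_eisenstein
    (hF : UniversalToricDescent.ToricPublishedInputs)
    (hI : UniversalToricDescent.AdditiveSplitIMCInclusionAtThree)
    (hE : SemiOrdinaryEisensteinDescent.WildSplitEisensteinInclusionAtThree)
    (hV : UniversalToricDescent.WildSplitWaldspurgerAtThree)
    (hC : UniversalToricDescent.WildSplitControlAtThree)
    (hZ : UniversalToricDescent.WildRankZeroTwistAtThree) :
    Summit.BirchSwinnertonDyer.WAllExclAddWildRankOneSurj := by
  unfold Summit.BirchSwinnertonDyer.WAllExclAddWildRankOneSurj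
  intro W _ _ _hncm hO6 hsurj hr
  obtain ⟨hGZ, hKo, hGZK, hmod, hmodP, -, hGZ73, hFH, hpar, hHP⟩ := hF
  haveI hN0 : NeZero (W.conductorNorm ℤ) := ⟨W.conductorNorm_pos_holds.ne'⟩
  -- (a) DATA. parity: `r_an = 1` is odd, so `w(E) = -1`
  have hw : W.rootNumber = -1 := by
    rcases W.rootNumber_eq_one_or with h | h
    · exfalso
      have heven : Even W.analyticRank := (hpar W).mpr h
      rw [hr] at heven
      exact Nat.not_even_one heven
    · exact h
  -- Friedberg–Hoffstein with auxiliary modulus `2`: Heegner for `N(E)` and `2` split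
  obtain ⟨K, _, _, hK, -, hHN, hH2, hLt⟩ := hFH W hw 2 two_ne_zero 0
  have hodd : Odd (NumberField.discr K) := by
    have h8 := Literature.SatisfiesHeegnerHypothesis.discr_emod_eight hK.1 hH2 (dvd_refl 2)
    rw [Int.odd_iff]; omega
  -- `3 ∣ N(E)` (additive) splits in `K`
  have h3N : 3 ∣ W.conductorNorm ℤ :=
    (W.dvd_conductorNorm_iff_not_hasGoodReductionAtPrime 3).mpr (not_good_of_addv W 3 hO6.2.1)
  have hsplit : SplitsIn K 3 := hHN 3 Nat.prime_three h3N
  -- the Heegner point over `K` and its data; non-torsion by Gross–Zagier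
  obtain ⟨P, Dt, H, ι, hP⟩ := hHP W K hK hHN
  have hL0 : W.entireLFunction 1 = 0 := entireLFunction_one_eq_zero_of_analyticRank_eq_one hr
  obtain ⟨-, hderiv⟩ := leadingLCoeff_eq_deriv_of_analyticRank_eq_one hr
  have hLK : LDerivEK W K ≠ 0 := by
    rw [lDerivEK_eq_deriv_mul W K hmod hL0]; exact mul_ne_zero hderiv hLt
  have hnt : ¬ IsOfFinAddOrder P :=
    (lDerivEK_ne_zero_iff_not_isOfFinAddOrder W (W.conductorNorm ℤ) K (hGZ _ W K) hK hHN
      ⟨Dt, H, ι, hP⟩).mp hLK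
  -- Kolyvagin: `rank E(K) = 1`, `Ш(E/K)` finite
  obtain ⟨hrk, hfin⟩ := hKo (W.conductorNorm ℤ) W K hK hHN ⟨Dt, H, ι, hP⟩ hnt
  -- a frame `(κ, γ, 𝔭)` and the other prime `𝔭′ ≠ 𝔭` above `3`
  obtain ⟨κ, γ, -, hκ, hγ, -⟩ := X11b.exists_anticyclotomic_generator_prime (p := 3) hK
  haveI : Fact (κ.IsTopGenerator γ) := ⟨hγ⟩
  obtain ⟨𝔭, h𝔭, he, hf⟩ := X11b.exists_degreeOnePrime_of_splitsIn K 3 hK.1 hsplit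
  obtain ⟨𝔭', hne, h𝔭', he', hf'⟩ := X11b.Three.exists_ne_degreeOne_prime hK.1 h𝔭 he hf
  -- (b) PLUMBING. Waldspurger frame and unit value at `(κ, γ, 𝔭)`
  obtain ⟨ι', hind, ΩK, Ωp, L, hΩK, hΩp, hBDP, u, hval⟩ :=
    hV W (W.conductorNorm ℤ) K Dt H ι P hO6 hsurj hr rfl hK hHN hLt hP hnt κ hκ γ 𝔭 h𝔭 he hf
  -- control count at `𝔭′` (CTL₀ included; supplies the torsion guard of the Eisenstein crux)
  have hctl : SchneiderFree.AdditiveControlOnTreeAt 3 κ 𝔭' γ (embAt K 3 𝔭' h𝔭' he' hf') P :=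
    hC W (W.conductorNorm ℤ) K Dt H ι P hO6 hsurj hr rfl hK hHN hLt hP hnt (hKo _ W K) κ hκ γ 𝔭'
      h𝔭' he' hf'
  obtain ⟨n, hn, hneq⟩ := hctl
  -- the EISENSTEIN INCLUSION `Ch_Λ(X_(∅,0))·R₀⟦T⟧ ⊆ (L)` at the frame (SOED's crux, torsion-guarded)
  have hincl : (XAc.charIdeal (W.baseChange K) 3 κ 𝔭' ∅ γ).map (PowerSeries.map (toUnr 3)) ≤
      Ideal.span {L} :=
    hE W (W.conductorNorm ℤ) K Dt hO6 hsurj hr rfl hK hHN κ hκ γ 𝔭 h𝔭 he hf 𝔭' h𝔭' hne ι' hind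
      ΩK Ωp L hΩK hΩp hBDP hn.1
  -- the value read through the logarithm at `𝔭′` (rank one: `(log_{𝔭′} P)² = (log_𝔭 P)²`)
  have hval' : L.HasValueAt 0 ((((u : unrIntegers 3) : unrIntegers 3) : ℂ_[3]) *
      (algebraMap ℚ_[3] ℂ_[3]
        (logOmega W 3 (embAt K 3 𝔭' h𝔭' he' hf') P / (Dt.c : ℚ_[3]))) ^ 2) :=
    (SchneiderFreeAdditiveX3.hasValueAt_sq_logOmega_embAt_iff_of_rank_one W 3 hK.1 hrk h𝔭 he hf
      h𝔭' he' hf' P _ _ L).mpr hval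
  -- the LOWER socket at slack `v₃(c)` at the frame `(κ, 𝔭′, γ, embAt 𝔭′)`
  have hc0 : Dt.c ≠ 0 := Dt.maninConstant_ne_zero_holds
  have hlog : logOmega W 3 (embAt K 3 𝔭' h𝔭' he' hf') P ≠ 0 := X11b.R1.logOmega_ne_zero W 3 _ hnt
  have hlow : SchneiderFree.AdditiveIMCLowerBDPOnTreeLeAt 3 κ 𝔭' γ (embAt K 3 𝔭' h𝔭' he' hf')
      (padicValNat 3 Dt.c.natAbs) P := by
    -- the LOWER norm receptacle (`⊆` + value): `2·ord₃(log_{𝔭′}P / c) ≤ ord₃ f(0)`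
    obtain ⟨htors, f, hfI, hf0, hfn⟩ := hn
    have hmem : PowerSeries.map (toUnr 3) f ∈ Ideal.span {L} := by
      have h3 := hincl
      rw [hfI, CongruenceLimit.map_span_singleton_powerSeries] at h3
      exact (Ideal.span_singleton_le_iff_mem _).mp h3
    obtain ⟨-, hle⟩ := Supersingular.two_mul_valuation_le_of_mem_span 3 hf0 hmem u hval'
    have hc0' : (Dt.c : ℚ_[3]) ≠ 0 := by exact_mod_cast hc0
    rw [div_eq_mul_inv, Padic.valuation_mul hlog (inv_ne_zero hc0'), Padic.valuation_inv,
      Padic.valuation_intCast, valuation_logOmega hlog, hfn] at hle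
    refine ⟨n, ⟨htors, f, hfI, hf0, hfn⟩, ?_⟩
    simp only [padicValInt] at hle
    linarith
  have hlo : SchneiderFree.IndexLowerBoundLeAt W 3 K P (padicValNat 3 Dt.c.natAbs) :=
    SchneiderFreeAdditiveX3.indexLowerBoundLeAt_of_imcLowerLe_of_control rfl hK hHN hfin hlow
      ⟨n, hn, hneq⟩
  -- the UPPER socket at slack `v₃(c)` from UTD's inclusion crux (§1; its own frame)
  have hupI : SchneiderFree.Upper.IndexUpperBoundLeAt W 3 K P (padicValNat 3 Dt.c.natAbs) :=
    indexUpperBoundLeAt_of_additiveSplitIMCInclusionAtThree hKo hI hV hC W (W.conductorNorm ℤ) K Dt H ι P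
      hO6 hsurj hr rfl hK hHN hLt hP hnt
  -- (c) TERMINAL STEP: a globally minimal model of the twist, then p528981
  have hD0 : (NumberField.discr K : ℚ) ≠ 0 := by exact_mod_cast NumberField.discr_ne_zero K
  haveI : (W.quadraticTwist (NumberField.discr K : ℚ)).IsElliptic := W.isElliptic_quadraticTwist hD0
  obtain ⟨Cd, hCd⟩ := hasGlobalMinimalModel_rat_holds (W.quadraticTwist (NumberField.discr K : ℚ))
  haveI : (Cd • W.quadraticTwist (NumberField.discr K : ℚ)).IsGloballyMinimal := hCd
  exact SchneiderFree.Exact.bsdp_three_of_exactIndexManin_of_wAllExclAddWildRankZero hGZ hKo hGZK hmod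
    hGZ73 hZ W hO6 hsurj hr (W.conductorNorm ℤ) K Dt H ι P
    (Cd • W.quadraticTwist (NumberField.discr K : ℚ)) rfl hK hodd hHN hLt hP ⟨Cd, rfl⟩ hlo hupI

/-! ### §3 The JET-PRODUCT sub-leaf from the inclusion alone -/

/-- **JET-PRODUCT SUB-LEAF CLASS THEOREM in inclusion currency.** For `W/ℚ` globally minimal on the wild cell
(`ClassO6 W 3`, `ρ̄_{E,3}` onto, `r_an = 1`) and ONE Heegner datum `(K, Dt, H, ι, P)` for `N(E)` with `d_K`
odd, `L(E^{d_K},1) ≠ 0` and `ord₃ [E(K):ℤP] ≤ ord₃ ∏_ℓ c_ℓ(E) + v₃(c(Dt))` (the census shape `i3 = t3` at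
`c = 1`; `≤` suffices, the upper socket forces equality): Gross–Zagier, Kolyvagin, GZK, modularity,
GZ I.7.3 (named facts, hypotheses) + `AdditiveSplitIMCInclusionAtThree` (UTD 20395) +
`WildSplitWaldspurgerAtThree` (20385) + `WildSplitControlAtThree` (20386) + the rank-zero wild leaf
`WAllExclAddWildRankZero` (hypothesis) ⟹ `BSDp W 3`. The «⊆» half of the main conjecture (SOED's E, UTD's
twin transport) is IDLE on such a datum: the upper socket of §1 and the index bound give both sockets
(gen 1's `indexBounds_of_upper_of_index_le`), then kmc g17's p528981. NO twin, NO Kolyvagin system, NO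
tower. CONDITIONAL; closes nothing; whether a computed index at one admissible `K` is an admissible
per-class input is the referee desks' call. [cite: JetchevSkinnerWan2017, §7.4.1 (arXiv:1512.06894 p. 30)]
[cite: Jetchev2008, Cor. 1.5 and (1) (Compos. Math. 144 (2008) p. 812)] [cite: GrossZagier1986, Thm. I.(6.3) and V.§2] -/
theorem bsdp_three_of_indexLeTamagawaManin_of_additiveSplitIMCInclusionAtThree
    (hGZ : ∀ (N : ℕ) [NeZero N] (W : WeierstrassCurve ℚ) (K : Type) [Field K] [NumberField K],
      gross_zagier N W K)
    (hKo : ∀ (N : ℕ) [NeZero N] (W : WeierstrassCurve ℚ) (K : Type) [Field K] [NumberField K],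
      kolyvagin N W K)
    (hGZK : rank_eq_analyticRank_of_analyticRank_le_one) (hmod : hasEntireLFunction_rat)
    (hGZ73 : GrossZagier1986_thm_I_7_3)
    (hI : UniversalToricDescent.AdditiveSplitIMCInclusionAtThree)
    (hV : UniversalToricDescent.WildSplitWaldspurgerAtThree)
    (hC : UniversalToricDescent.WildSplitControlAtThree)
    (hRZ : Summit.BirchSwinnertonDyer.WAllExclAddWildRankZero)
    (W : WeierstrassCurve ℚ) [W.IsElliptic] [W.IsGloballyMinimal] [NeZero (W.conductorNorm ℤ)]
    (hO6 : ClassO6 W 3) (hsurj : W.HasSurjectiveModNGaloisRep 3) (hr : W.analyticRank = 1)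
    (K : Type) [Field K] [NumberField K]
    (Dt : ModularParametrizationData W (W.conductorNorm ℤ))
    (H : HeegnerDatum (W.conductorNorm ℤ) (NumberField.discr K)) (ι : K →+* ℂ)
    (P : (W.baseChange K).toAffine.Point)
    (hK : IsImaginaryQuadratic K) (hodd : Odd (NumberField.discr K))
    (hHH : SatisfiesHeegnerHypothesis (W.conductorNorm ℤ) K)
    (hLd : (W.quadraticTwist (NumberField.discr K : ℚ)).entireLFunction 1 ≠ 0)
    (hP : WeierstrassCurve.Affine.Point.map ι.toRatAlgHom P = heegnerPointComplex Dt H)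
    (hIdx : padicValNat 3 (AddSubgroup.zmultiples P).index ≤
      padicValNat 3 W.tamagawaProduct + padicValNat 3 Dt.c.natAbs) :
    BSDp W 3 := by
  -- the Heegner point is non-torsion (Gross–Zagier)
  have hL0 : W.entireLFunction 1 = 0 := entireLFunction_one_eq_zero_of_analyticRank_eq_one hr
  obtain ⟨-, hderiv⟩ := leadingLCoeff_eq_deriv_of_analyticRank_eq_one hr
  have hLK : LDerivEK W K ≠ 0 := by
    rw [lDerivEK_eq_deriv_mul W K hmod hL0]; exact mul_ne_zero hderiv hLd
  have hnt : ¬ IsOfFinAddOrder P :=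
    (lDerivEK_ne_zero_iff_not_isOfFinAddOrder W (W.conductorNorm ℤ) K (hGZ _ W K) hK hHH
      ⟨Dt, H, ι, hP⟩).mp hLK
  -- the upper socket at slack `v₃(c)` from the inclusion (§1), then both sockets (gen 1 §1)
  have hup : SchneiderFree.Upper.IndexUpperBoundLeAt W 3 K P (padicValNat 3 Dt.c.natAbs) :=
    indexUpperBoundLeAt_of_additiveSplitIMCInclusionAtThree hKo hI hV hC W (W.conductorNorm ℤ) K Dt H ι P
      hO6 hsurj hr rfl hK hHH hLd hP hnt
  obtain ⟨-, hlo, -⟩ := SchneiderFree.Exact.indexBounds_of_upper_of_index_le hup hIdx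
  -- a globally minimal model of the twist, then kmc g17's descent with the rank-zero wild leaf
  have hD0 : (NumberField.discr K : ℚ) ≠ 0 := by exact_mod_cast NumberField.discr_ne_zero K
  haveI : (W.quadraticTwist (NumberField.discr K : ℚ)).IsElliptic := W.isElliptic_quadraticTwist hD0
  obtain ⟨Cd, hCd⟩ := hasGlobalMinimalModel_rat_holds (W.quadraticTwist (NumberField.discr K : ℚ))
  haveI : (Cd • W.quadraticTwist (NumberField.discr K : ℚ)).IsGloballyMinimal := hCd
  exact SchneiderFree.Exact.bsdp_three_of_exactIndexManin_of_wAllExclAddWildRankZero hGZ hKo hGZK hmod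
    hGZ73 hRZ W hO6 hsurj hr (W.conductorNorm ℤ) K Dt H ι P
    (Cd • W.quadraticTwist (NumberField.discr K : ℚ)) rfl hK hodd hHH hLd hP ⟨Cd, rfl⟩ hlo hup

end Summit.BirchSwinnertonDyer.BirchSwinnertonDyer.Theorems.WildThreeInclusionKernel

end
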